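import Mathlib
import Summits.QuantumFields.YangMills.Theorems.BalabanUVNodesN15BackgroundLayerFirstOrderFull
import HarnessLib

/-!
# Route «BalabanUVNodes» (cluster K4 «SpineRates»), Track-A DAG node N15 = spine estimate NE2, BACKGROUND LAYER — THE FOUR (3.42) ENTRIES OF THE
# FIRST-ORDER BACKGROUND-DEPENDENT PAIR FROM THE THREE PERTURBATION LETTERS, ONCE AND FOR ALL: for ANY local first-order perturbation `V̂` of the
# stacked `U ≡ 1` layer with diagonal majorants `V̂, V̂′ ≤ diagK R` and diagonal η-defect `𝔇(V̂′, V̂) ≤ diagK (Rθ)`, under the guard `R ≤ K·a₀`,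
# `β(Ka₀)c_r ≤ ½`, the entry defects are `≤ {bgConst, bgConst1}(β, c_r, m₀, K, a₀)·θ·e^{−(δ−σ)d}` — the species-independent half of B4∕C2∕M3∕G2

Cell `pub-ymgap`, seat `pub-ymgap-dag-n15-c` (generation g2; R134 ACCELERATION SEAT, strategy s1; HUMAN RULING D-0062; chair R424 venue).  `bears_on: R4∕N15`.
Filed `--supports stmt-QuantumFields-19676` (K3; helper).  Imports BY NAME, nothing in the tree modified: n15-b's B4 `…N15BackgroundLayerFirstOrderFull` (through
it B1a∕B1b∕B3: `bgPropV`, `hasMaj_idef_bgPropV`, `bgSourceV`, `bgDerivedV`, `hasMaj_idef_bgSourceV`, `hasMaj_idef_bgDerivedV`, `stack`, `projO`, `blkPair`,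
`liftPair`, `hasMaj_stack`, `idef_stack`, `hasMaj_projO_comp`, `poly0_le`, `bgConst`, `bgConst1`, `inv_one_sub_le_two`).

WHY.  Every by-name readout of the first-order background layer in the tree — n15-b's B4 (abstract scalar coefficients), C2 (abelian gauge field), this seat's
M3 (abstract matrix coefficients) and G2 (`𝔄`-valued gauge field) — repeats the SAME forty-line argument: stack the `U ≡ 1` layer, feed B1a's
`hasMaj_idef_bgPropV` ∕ B3's `hasMaj_idef_bgSourceV` ∕ `hasMaj_idef_bgDerivedV` with the three perturbation letters, bound `(1 − q)⁻¹ ≤ 2`, and close the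
polynomial arithmetic with `poly0_le` ∕ `bgConst1`.  Only the LETTERS depend on the species.  THIS FILE states that argument ONCE, for an ARBITRARY linear
perturbation `V̂ : (X × Option J → ℝ) → (X → ℝ)` of the stacked layer (coarse) and `V̂′` (fine) — so the next species (the print's `V′₁(A)` of (3.52) on the
forward∕backward stack, a nonlinear (C3) transport, the `F′_{1,k}` term, …) is reduced to producing `hV`, `hV′`, `hDV`.  Lattices are arbitrary: the product
carrier `X × ι` of M1–M4∕G1–G3 is the instance `blk ↦ liftBlk blk ι`, `π ↦ liftMap π ι`.

CONTENTS ([folklore] bookkeeping; 0 defs).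
* §1 `idef_projO_comp` (the component of an η-difference over the stack is the η-difference of the components — the `hcomp` step of C2∕M1∕M3∕G2, named).
* §2 **`hasMaj_entries_of_letters`** — THE FOUR ENTRY DEFECTS FROM THE THREE LETTERS under the guard: entries 0∕1 (`∀ j`, components of B1a's `bgPropV` over the
  stack), entry 2 (`none` component of B3's source step `bgSourceV`), entry 3 (B3's derived object `bgDerivedV`) — `≤ bgConst(β, c_r, m₀, K, a₀)·θ·e^{−(δ−σ)d}`
  resp. `bgConst1(…)` — for ANY `V̂, V̂′` with `V̂, V̂′ ≤ diagK R`, `𝔇(V̂′, V̂) ≤ diagK (Rθ)`, `0 ≤ R ≤ K·a₀`, `β(Ka₀)c_r ≤ ½`.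
* §3 `entryMajorant_le_etaRateShape` — the domination of an entry majorant `B·θ·e^{−δ₀d}` into the `EtaRateIneq342` shape
  `B₀·pref4·e^{−δ₀d}·max(rateFactor y, rateFactor y′)` (`B ≤ B₀`, `θ ≤ rateWeight`, sites of size `≥ 1`), ready for g0's `etaRateIneq342_of_hasMaj` (the
  `hdom` step of B4∕C2∕M3∕G2, named).

HONEST FRAMING ∕ LIMITS.  Pure bookkeeping over hypothesis-shaped data (a refactoring lemma: no new estimate); the `U ≡ 1` layer and the perturbation letters are
DISPLAYED; nothing about Bałaban's `G(U)` asserted.  NE2⁺ NOT PRINTED, NOT proved; count-neutral (typed 28∕28; nothing discharged); N15 NOT discharged; one finite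
lattice at fixed ε — NOT infinite volume, NOT OS on ℝ⁴, NOT a mass gap, NOT Clay.
-/

noncomputable section

namespace Summit.QuantumFields.YangMills.BalabanUVNodes.N15.BackgroundLayer

open Literature.MathematicalPhysics.QuantumFieldTheory.Balaban1983to89
open Literature.MathematicalPhysics.QuantumFieldTheory.Balaban1983to89.B11SectG (BlockNorm HasMaj RowSum)
open Literature.MathematicalPhysics.QuantumFieldTheory.Balaban1983to89.T4EtaRate (rateFactor)
open Literature.MathematicalPhysics.QuantumFieldTheory.Balaban1983to89.T4EtaRateDefect (idef rateWeight)
open Literature.MathematicalPhysics.QuantumFieldTheory.Balaban1983to89.T4EtaRateCoeffDefect (pull diagK)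
open Literature.MathematicalPhysics.QuantumFieldTheory.Balaban1983to89.B6RandomWalk (Triangle254)
open Literature.MathematicalPhysics.QuantumFieldTheory.Balaban1983to89.B9SectDSup (inv_one_sub_le_two)
open Summit.QuantumFields.YangMills.BalabanUVNodes.N15.OperatorReadout (opGeo opGeo_len rateFactor_opGeo)

/-! ## §1 Components of an η-difference over the stack -/

section Component

variable {X X' J : Type} {F F' : Type} [AddCommGroup F] [Module ℝ F] [AddCommGroup F'] [Module ℝ F']

/-- THE COMPONENT OF AN η-DIFFERENCE OVER THE STACK IS THE η-DIFFERENCE OF THE COMPONENTS: for `T : F → (X × Option J → ℝ)`, `T′ : F′ → (X′ × Option J → ℝ)` and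
the pairings `τ₁ : F → F′`, `pull π`, `pull (liftPair π)`: `𝔇(pr_j T′, pr_j T) = pr_j ∘ 𝔇(T′, T)` (the `hcomp` step of C2∕M1∕M3∕G2, by `rfl` pointwise). [folklore] -/
theorem idef_projO_comp (τ₁ : F →ₗ[ℝ] F') (π : X' → X) (T' : F' →ₗ[ℝ] (X' × Option J → ℝ)) (T : F →ₗ[ℝ] (X × Option J → ℝ)) (j : Option J) :
    idef τ₁ (pull π) (projO j ∘ₗ T') (projO j ∘ₗ T) = projO j ∘ₗ idef τ₁ (pull (liftPair π)) T' T :=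
  LinearMap.ext fun _ => funext fun _ => rfl

end Component

/-! ## §2 The four entries from the three perturbation letters, under the guard -/

section Entries

variable {X X' J : Type} [Fintype X] [Fintype X'] [Fintype J] [DecidableEq X] [DecidableEq X'] [DecidableEq J] {g : B6.Geometry}
  (blk : X → g.Site) (π : X' → X)
variable {G S D₃ : (X → ℝ) →ₗ[ℝ] (X → ℝ)} {D SD : J → (X → ℝ) →ₗ[ℝ] (X → ℝ)} {G' S' D₃' : (X' → ℝ) →ₗ[ℝ] (X' → ℝ)}
  {D' SD' : J → (X' → ℝ) →ₗ[ℝ] (X' → ℝ)} {V : (X × Option J → ℝ) →ₗ[ℝ] (X → ℝ)} {V' : (X' × Option J → ℝ) →ₗ[ℝ] (X' → ℝ)}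

/-- **THE FOUR ENTRY DEFECTS FROM THE THREE PERTURBATION LETTERS, UNDER THE GUARD.**  Data: a [B6] carrier ((2.54), `d ≥ 0`, (2.61) at `σ ≥ 0`, `c_r ≥ 0`); lattices
`X, X′` blocked by `blk`, `blk ∘ π`, paired by `π`; the `U ≡ 1` LAYER — `G, D_μ, S, SD_μ` (coarse), `G′, D′_μ, D₃′` (fine) `≤ β·e^{−δd}`, the five η-defects
`𝔇(G′,G), 𝔇(D′_μ,D_μ), 𝔇(S′,S), 𝔇(SD′_μ,SD_μ), 𝔇(D₃′,D₃) ≤ m₀·θ·e^{−δd}`, `σ ≤ δ`, `β, m₀, θ ≥ 0`; ANY first-order perturbations of the stacked layer, `V̂` (coarse)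
and `V̂′` (fine), with the THREE LETTERS `V̂ ≤ diagK R`, `V̂′ ≤ diagK R`, `𝔇(V̂′, V̂) ≤ diagK (R·θ)` through `(pull (liftPair π), pull π)`; the GUARD `0 ≤ R ≤ K·a₀`,
`K, a₀ ≥ 0`, `β·(K·a₀)·c_r ≤ ½`.  CONCLUSION: with `X̂ = bgPropV (stack G D) V̂` (B1a), `Ẑ = bgSourceV (stack G D) (stack S SD) V̂`, `Ŷ₃ = bgDerivedV (stack G D) D₃ V̂`
(B3) and their fine twins: (0∕1) `𝔇(pr_j X̂′, pr_j X̂) ≤ bgConst(β, c_r, m₀, K, a₀)·θ·e^{−(δ−σ)d}` for every `j : Option J`; (2) `𝔇(pr_none Ẑ′, pr_none Ẑ) ≤` the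
same; (3) `𝔇(Ŷ₃′, Ŷ₃) ≤ bgConst1(β, c_r, m₀, K, a₀)·θ·e^{−(δ−σ)d}`.  The species-independent half of B4∕C2∕M3∕G2.
[cite: Balaban1985BackgroundPropagators, Thm 3.1 (3.42) p.397 (entries: shapes); (3.63)–(3.65) pp.402–403 (mechanism)] -/
theorem hasMaj_entries_of_letters (htri : Triangle254 g) (hd : ∀ a b : g.Site, 0 ≤ g.dist a b) {σ cr : ℝ} (hσ : 0 ≤ σ) (hcr : 0 ≤ cr) (hrow : RowSum g σ cr)
    {δ β m₀ θ K a₀ R : ℝ} (hσδ : σ ≤ δ) (hβ : 0 ≤ β) (hm₀ : 0 ≤ m₀) (hθ : 0 ≤ θ) (hK : 0 ≤ K) (ha₀ : 0 ≤ a₀) (hq : β * (K * a₀) * cr ≤ 1 / 2)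
    (hR0 : 0 ≤ R) (hRa : R ≤ K * a₀)
    (hG : HasMaj (BlockNorm.ofBlocks g blk) (BlockNorm.ofBlocks g blk) G (fun y y' => β * Real.exp (-(δ * g.dist y y'))))
    (hD : ∀ μ, HasMaj (BlockNorm.ofBlocks g blk) (BlockNorm.ofBlocks g blk) (D μ) (fun y y' => β * Real.exp (-(δ * g.dist y y'))))
    (hG' : HasMaj (BlockNorm.ofBlocks g (blk ∘ π)) (BlockNorm.ofBlocks g (blk ∘ π)) G' (fun y y' => β * Real.exp (-(δ * g.dist y y'))))
    (hD' : ∀ μ, HasMaj (BlockNorm.ofBlocks g (blk ∘ π)) (BlockNorm.ofBlocks g (blk ∘ π)) (D' μ) (fun y y' => β * Real.exp (-(δ * g.dist y y'))))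
    (hS : HasMaj (BlockNorm.ofBlocks g blk) (BlockNorm.ofBlocks g blk) S (fun y y' => β * Real.exp (-(δ * g.dist y y'))))
    (hSD : ∀ μ, HasMaj (BlockNorm.ofBlocks g blk) (BlockNorm.ofBlocks g blk) (SD μ) (fun y y' => β * Real.exp (-(δ * g.dist y y'))))
    (hD₃' : HasMaj (BlockNorm.ofBlocks g (blk ∘ π)) (BlockNorm.ofBlocks g (blk ∘ π)) D₃' (fun y y' => β * Real.exp (-(δ * g.dist y y'))))
    (hDG : HasMaj (BlockNorm.ofBlocks g blk) (BlockNorm.ofBlocks g (blk ∘ π)) (idef (pull π) (pull π) G' G)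
      (fun y y' => m₀ * θ * Real.exp (-(δ * g.dist y y'))))
    (hDD : ∀ μ, HasMaj (BlockNorm.ofBlocks g blk) (BlockNorm.ofBlocks g (blk ∘ π)) (idef (pull π) (pull π) (D' μ) (D μ))
      (fun y y' => m₀ * θ * Real.exp (-(δ * g.dist y y'))))
    (hDS : HasMaj (BlockNorm.ofBlocks g blk) (BlockNorm.ofBlocks g (blk ∘ π)) (idef (pull π) (pull π) S' S)
      (fun y y' => m₀ * θ * Real.exp (-(δ * g.dist y y'))))
    (hDSD : ∀ μ, HasMaj (BlockNorm.ofBlocks g blk) (BlockNorm.ofBlocks g (blk ∘ π)) (idef (pull π) (pull π) (SD' μ) (SD μ))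
      (fun y y' => m₀ * θ * Real.exp (-(δ * g.dist y y'))))
    (hDD₃ : HasMaj (BlockNorm.ofBlocks g blk) (BlockNorm.ofBlocks g (blk ∘ π)) (idef (pull π) (pull π) D₃' D₃)
      (fun y y' => m₀ * θ * Real.exp (-(δ * g.dist y y'))))
    (hV : HasMaj (BlockNorm.ofBlocks g (blkPair blk)) (BlockNorm.ofBlocks g blk) V (diagK fun _ => R))
    (hV' : HasMaj (BlockNorm.ofBlocks g (blkPair (blk ∘ π))) (BlockNorm.ofBlocks g (blk ∘ π)) V' (diagK fun _ => R))
    (hDV : HasMaj (BlockNorm.ofBlocks g (blkPair blk)) (BlockNorm.ofBlocks g (blk ∘ π)) (idef (pull (liftPair π)) (pull π) V' V)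
      (diagK fun _ => R * θ)) :
    (∀ j : Option J, HasMaj (BlockNorm.ofBlocks g blk) (BlockNorm.ofBlocks g (blk ∘ π))
      (idef (pull π) (pull π) (projO j ∘ₗ bgPropV (stack G' D') V') (projO j ∘ₗ bgPropV (stack G D) V))
      (fun y y' => bgConst β cr m₀ K a₀ * θ * Real.exp (-((δ - σ) * g.dist y y')))) ∧
    HasMaj (BlockNorm.ofBlocks g blk) (BlockNorm.ofBlocks g (blk ∘ π))
      (idef (pull π) (pull π) (projO none ∘ₗ bgSourceV (stack G' D') (stack S' SD') V') (projO none ∘ₗ bgSourceV (stack G D) (stack S SD) V))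
      (fun y y' => bgConst β cr m₀ K a₀ * θ * Real.exp (-((δ - σ) * g.dist y y'))) ∧
    HasMaj (BlockNorm.ofBlocks g blk) (BlockNorm.ofBlocks g (blk ∘ π))
      (idef (pull π) (pull π) (bgDerivedV (stack G' D') D₃' V') (bgDerivedV (stack G D) D₃ V))
      (fun y y' => bgConst1 β cr m₀ K a₀ * θ * Real.exp (-((δ - σ) * g.dist y y'))) := by
  have hq' : β * R * cr ≤ 1 / 2 := (mul_le_mul_of_nonneg_right (mul_le_mul_of_nonneg_left hRa hβ) hcr).trans hq
  have hq1 : β * R * cr < 1 := by linarith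
  have hinv : (1 - β * R * cr)⁻¹ ≤ 2 := inv_one_sub_le_two hq'
  have hinv0 : 0 ≤ (1 - β * R * cr)⁻¹ := inv_nonneg.2 (by linarith)
  have hβe : ∀ y y' : g.Site, 0 ≤ β * Real.exp (-(δ * g.dist y y')) := fun _ _ => mul_nonneg hβ (Real.exp_nonneg _)
  have hme : ∀ y y' : g.Site, 0 ≤ m₀ * θ * Real.exp (-(δ * g.dist y y')) := fun _ _ => mul_nonneg (mul_nonneg hm₀ hθ) (Real.exp_nonneg _)
  have hSG := hasMaj_stack blk hβe hG hD
  have hSG' := hasMaj_stack (blk ∘ π) hβe hG' hD'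
  have hSS := hasMaj_stack blk hβe hS hSD
  have hSDG : HasMaj (BlockNorm.ofBlocks g blk) (BlockNorm.ofBlocks g (blkPair (blk ∘ π)))
      (idef (pull π) (pull (liftPair π)) (stack G' D') (stack G D)) (fun y y' => m₀ * θ * Real.exp (-(δ * g.dist y y'))) := by
    rw [idef_stack]; exact hasMaj_stack (blk ∘ π) hme hDG hDD
  have hSDS : HasMaj (BlockNorm.ofBlocks g blk) (BlockNorm.ofBlocks g (blkPair (blk ∘ π)))
      (idef (pull π) (pull (liftPair π)) (stack S' SD') (stack S SD)) (fun y y' => m₀ * θ * Real.exp (-(δ * g.dist y y'))) := by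
    rw [idef_stack]; exact hasMaj_stack (blk ∘ π) hme hDS hDSD
  have hRθ0 : 0 ≤ R * θ := mul_nonneg hR0 hθ
  set u : ℝ := (1 - β * R * cr)⁻¹ with hu_def
  have h0 := poly0_le (β := β) (cr := cr) (m₀ := m₀) (θ := θ) (c35 := K) (a₀ := a₀) (r := R) (u := u) hβ hcr hm₀ hθ hR0 hRa hinv0 hinv
  have hE : ∀ a b : g.Site, 0 ≤ Real.exp (-((δ - σ) * g.dist a b)) := fun _ _ => Real.exp_nonneg _
  refine ⟨fun j => ?_, ?_, ?_⟩
  · have key := hasMaj_idef_bgPropV blk (blkPair blk) π (liftPair π) htri hd hσ hcr hrow (ρ := δ - σ) (by linarith) (by linarith) hβ hR0 hRθ0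
      (mul_nonneg hm₀ hθ) hSG hSG' hSDG hV hV' hDV hq1
    have keyj := hasMaj_projO_comp (blk ∘ π) key j
    rw [idef_projO_comp]
    refine keyj.mono fun a b => ?_
    simp only [one_mul]
    exact mul_le_mul_of_nonneg_right h0 (hE a b)
  · have key := hasMaj_idef_bgSourceV blk (blkPair blk) π (liftPair π) htri hd hσ hcr hrow (ρ := δ - σ) (by linarith) (by linarith) hβ hR0 hRθ0
      (mul_nonneg hm₀ hθ) (mul_nonneg hm₀ hθ) hSG hSG' hSS hSDG hSDS hV hV' hDV hq1
    have keyj := hasMaj_projO_comp (blk ∘ π) key none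
    rw [idef_projO_comp]
    refine keyj.mono fun a b => ?_
    simp only [one_mul, mul_one]
    exact mul_le_mul_of_nonneg_right h0 (hE a b)
  · have key := hasMaj_idef_bgDerivedV blk (blkPair blk) π (liftPair π) htri hd hσ hcr hrow (ρ := δ - σ) (by linarith) (by linarith) hβ hR0 hRθ0
      (mul_nonneg hm₀ hθ) (mul_nonneg hm₀ hθ) hSG hSG' hD₃' hSDG hDD₃ hV hV' hDV hq1
    refine key.mono fun a b => ?_
    simp only [one_mul]
    refine mul_le_mul_of_nonneg_right ?_ (hE a b)
    have hKa : 0 ≤ K * a₀ := mul_nonneg hK ha₀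
    have h2 : m₀ * θ * cr * (R * (β * u)) ≤ m₀ * θ * cr * (K * a₀ * (β * 2)) := by gcongr
    have h3 : β * R * cr * ((m₀ * θ * cr + m₀ * θ * cr * (R * (β * u)) + β * (R * θ) * (β * u) * cr) * u) ≤ 1 / 2 * (bgConst β cr m₀ K a₀ * θ) :=
      mul_le_mul hq' h0 (by positivity) (by norm_num)
    have h4 : β * (R * θ) * (β * u) * cr ≤ β * (K * a₀ * θ) * (β * 2) * cr := by gcongr
    calc m₀ * θ * cr + m₀ * θ * cr * (R * (β * u)) +
          β * R * cr * ((m₀ * θ * cr + m₀ * θ * cr * (R * (β * u)) + β * (R * θ) * (β * u) * cr) * u) + β * (R * θ) * (β * u) * cr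
        ≤ m₀ * θ * cr + m₀ * θ * cr * (K * a₀ * (β * 2)) + 1 / 2 * (bgConst β cr m₀ K a₀ * θ) + β * (K * a₀ * θ) * (β * 2) * cr :=
          add_le_add (add_le_add (add_le_add le_rfl h2) h3) h4
      _ = bgConst1 β cr m₀ K a₀ * θ := by unfold bgConst1; ring

end Entries

/-! ## §3 The same, dominated into the `EtaRateIneq342` shape -/

section Dominated

variable {X X' J : Type} [Fintype X] [Fintype X'] [Fintype J] [DecidableEq X] [DecidableEq X'] [DecidableEq J] {g : B6.Geometry}
  (blk : X → g.Site) (π : X' → X)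

omit [Fintype X'] [Fintype J] [DecidableEq X] [DecidableEq X'] [DecidableEq J] in
/-- DOMINATION INTO THE (3.42) SHAPE: for sites of size `≥ 1` (`pref4 ≥ 1`), `0 ≤ θ ≤ rateWeight γ` (`= rateFactor` on the realised geometry `opGeo`),
`η > 0`, `L > 0`, `0 ≤ B ≤ B₀`: `B·θ·e^{−δ₀d(y,y′)} ≤ B₀·pref4(len y, n)·e^{−δ₀d(y,y′)}·max(rateFactor y, rateFactor y′)` — the `hdom` step of B4∕C2∕M3∕G2, named.
[cite: Balaban1985BackgroundPropagators, Thm 3.1 (3.42) p.397 (shape)] -/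
theorem entryMajorant_le_etaRateShape (hη : 0 < g.eta) (hL : 0 < g.L) (hlen : ∀ y, 1 ≤ g.len y)
    {θ γ δ₀ B B₀ : ℝ} (hθ : 0 ≤ θ) (hθγ : ∀ y, θ ≤ rateWeight g γ y) (hB0 : 0 ≤ B) (hB : B ≤ B₀) (n : Fin 4) (y y' : g.Site) :
    B * θ * Real.exp (-(δ₀ * g.dist y y')) ≤
      B₀ * B9.pref4 ((opGeo g X blk).len y) n * Real.exp (-(δ₀ * g.dist y y')) *
        max (rateFactor (opGeo g X blk) γ y) (rateFactor (opGeo g X blk) γ y') := by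
  have hB₀ : 0 ≤ B₀ := hB0.trans hB
  have hpref : 1 ≤ B9.pref4 ((opGeo g X blk).len y) n := by rw [opGeo_len]; exact one_le_pref4 (hlen y) n
  have hrf : θ ≤ max (rateFactor (opGeo g X blk) γ y) (rateFactor (opGeo g X blk) γ y') := by
    rw [rateFactor_opGeo g X blk hη.ne' hL γ y']
    exact (hθγ y').trans (le_max_right _ _)
  have hE : 0 ≤ Real.exp (-(δ₀ * g.dist y y')) := Real.exp_nonneg _
  calc B * θ * Real.exp (-(δ₀ * g.dist y y'))
      ≤ (B₀ * B9.pref4 ((opGeo g X blk).len y) n) * θ * Real.exp (-(δ₀ * g.dist y y')) := by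
        refine mul_le_mul_of_nonneg_right (mul_le_mul_of_nonneg_right ?_ hθ) hE
        calc B = B * 1 := (mul_one B).symm
          _ ≤ _ := mul_le_mul hB hpref zero_le_one hB₀
    _ = B₀ * B9.pref4 ((opGeo g X blk).len y) n * Real.exp (-(δ₀ * g.dist y y')) * θ := by ring
    _ ≤ _ := mul_le_mul_of_nonneg_left hrf (mul_nonneg (mul_nonneg hB₀ (zero_le_one.trans hpref)) hE)

end Dominated

end Summit.QuantumFields.YangMills.BalabanUVNodes.N15.BackgroundLayer
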